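import Literature.MathematicalPhysics.QuantumLattice.LocalUnitaryDressedSlaterBound
import HarnessLib

/-!
# The dressed-cluster (local-unitary-dressed Slater determinant) energy bound

Topic `MathematicalPhysics/QuantumLattice`, family `hubbard`; assembles
`HartreeFockUpperBound.lean`, `SlaterWindowReducedDensityMatrix.lean` and
`LocalUnitaryDressedSlaterBound.lean` into ONE variational upper bound whose right-hand side is an
explicit finite expression in: the window blocks of a one-particle projection `P`, the entries of
the dressing unitaries, and the local pieces of the Hamiltonian.

**Setting.** A finite set `Λ` of sites is tiled by CELLS `φ_c : Λ₀ ↪ Λ` (`c : C`) with pairwise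
disjoint images; LINK windows `ψ_ℓ : Λ₁ ↪ Λ` (`ℓ : D`) each consist of two distinct cells
`src ℓ ≠ tgt ℓ`, placed in `Λ₁` by two fixed charts `ι₁, ι₂ : Λ₀ ↪ Λ₁` covering `Λ₁`
(`ι₁ ≫ ψ_ℓ = φ_{src ℓ}`, `ι₂ ≫ ψ_ℓ = φ_{tgt ℓ}`). An operator `H` on the Fock space of `Λ` is
CLUSTER-DECOMPOSED if `H = Σ_c Γ(φ_c) h₁(c) + Σ_ℓ Γ(ψ_ℓ) h₂(ℓ)` for cell operators `h₁(c)` and link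
operators `h₂(ℓ)` (for a nearest-neighbour Hamiltonian: on-site and intra-cell terms, resp. the
bonds between two adjacent cells). The trial state is `Ψ = 𝒰 Φ_P`, `𝒰 = ∏_c Γ(φ_c) u_c`, with
`u_cᴴ u_c = 1` and `[N̂, u_c] = 0` (so the factors are even and commute pairwise).

* `DressedCluster.dressing` — the product `𝒰` (a `Finset.noncommProd`; the commutativity is
  `commute_fermionEmbed_of_disjoint`); `conjTranspose_dressing_mul_self` (`𝒰ᴴ 𝒰 = 1`),
  `commute_totalNumberOp_dressing`;
* `DressedCluster.dressing_conj_cell` — **light cone, cell terms**: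
  `𝒰ᴴ Γ(φ_c)X 𝒰 = Γ(φ_c)(u_cᴴ X u_c)`; `DressedCluster.dressing_conj_link` — **link terms**:
  `𝒰ᴴ Γ(ψ_ℓ)Y 𝒰 = Γ(ψ_ℓ)(V_ℓᴴ Y V_ℓ)` with the TWO-CELL dressing
  `V_ℓ = Γ(ι₁) u_{src ℓ} · Γ(ι₂) u_{tgt ℓ}` computed inside the link window;
* `DressedCluster.groundEnergy_le` — **the bound**: for an orthogonal projection `P` on the
  one-particle space of `Λ` with `tr P = N` and a cluster-decomposed `H`,
  `E_N(H) ≤ Re [ Σ_c Σ_{s,t} (u_cᴴ h₁(c) u_c)_{st} ρ_P^{φ_c}(s,t) + Σ_ℓ Σ_{s,t} (V_ℓᴴ h₂(ℓ) V_ℓ)_{st} ρ_P^{ψ_ℓ}(s,t) ]`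
  where `ρ_P^{φ}(s,t) = slaterRDM (P|_φ) s t` is the explicit window reduced density matrix of
  `SlaterWindowReducedDensityMatrix.lean`. Every quantity on the right is a finite polynomial in
  the entries of `P`, `u_c`, `h₁`, `h₂`.

This is the soundness theorem of "plaquette local-unitary-cluster" upper bounds on Hubbard
ground-state energies (a Slater determinant dressed by one optimised unitary per plaquette,
evaluated exactly by Wick's theorem on `2 × (cell)`-site windows); the instantiation for the square
torus tiled by `2 × 2` plaquettes is a separate file. Sources for the ingredients: Bach–Lieb–Solovej
1994 (2c.36) and Thm 2.3 [BachLiebSolovej1994]; Bratteli–Robinson II §5.2.2 [BratteliRobinsonII1997].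
As a numerical variational family such states are classical (e.g. local correlators on top of the
antiferromagnetic Hartree–Fock state, Polatsek–Becker, Phys. Rev. B 54 (1996) 1637); the point here is
the exact, machine-checked reduction to finitely many window quantities. Everything is proved; the
one definition (`dressing`) has a body; no named facts.
-/

noncomputable section

namespace Literature.MathematicalPhysics.QuantumLattice

open Matrix Finset HubbardWave0
open scoped ComplexOrder Function

namespace DressedCluster

variable {Λ₀ Λ₁ Λ : Type*} [LinearOrder Λ₀] [Fintype Λ₀] [LinearOrder Λ₁] [Fintype Λ₁]
  [LinearOrder Λ] [Fintype Λ] {C : Type*} [Fintype C] [DecidableEq C]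

/-! ### The dressing `𝒰 = ∏_c Γ(φ_c) u_c` -/

omit [DecidableEq C] in
/-- The factors `Γ(φ_c) u_c` of cells with disjoint images commute when the `u_c` conserve the
particle number (they are even). [cite: BratteliRobinsonII1997, §5.2.2] -/
theorem pairwise_commute_fermionEmbed (φ : C → (Λ₀ ↪ Λ))
    (hdisj : ∀ c c', c ≠ c' → Disjoint ((univ : Finset Λ₀).map (φ c)) ((univ : Finset Λ₀).map (φ c')))
    (u : C → Matrix (Finset (Orb Λ₀)) (Finset (Orb Λ₀)) ℂ) (huN : ∀ c, Commute totalNumberOp (u c)) :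
    Set.Pairwise (↑(univ : Finset C) : Set C) (Commute on fun c => fermionEmbed (φ c) (u c)) :=
  fun c _ c' _ hcc' => commute_fermionEmbed_of_disjoint (φ c) (φ c') (hdisj c c' hcc')
    (mem_carEvenSubalgebra_univ_of_commute_totalNumberOp (huN c)) (u c')

omit [DecidableEq C] in
/-- **The dressing unitary** `𝒰 = ∏_c Γ(φ_c) u_c` of a family of cells with disjoint images and
particle-number conserving cell operators `u_c` (the order of the commuting factors is immaterial).
[cite: BratteliRobinsonII1997, §5.2.2] -/
def dressing (φ : C → (Λ₀ ↪ Λ))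
    (hdisj : ∀ c c', c ≠ c' → Disjoint ((univ : Finset Λ₀).map (φ c)) ((univ : Finset Λ₀).map (φ c')))
    (u : C → Matrix (Finset (Orb Λ₀)) (Finset (Orb Λ₀)) ℂ) (huN : ∀ c, Commute totalNumberOp (u c)) :
    Matrix (Finset (Orb Λ)) (Finset (Orb Λ)) ℂ :=
  (univ : Finset C).noncommProd (fun c => fermionEmbed (φ c) (u c)) (pairwise_commute_fermionEmbed φ hdisj u huN)

variable (φ : C → (Λ₀ ↪ Λ))
  (hdisj : ∀ c c', c ≠ c' → Disjoint ((univ : Finset Λ₀).map (φ c)) ((univ : Finset Λ₀).map (φ c')))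
  (u : C → Matrix (Finset (Orb Λ₀)) (Finset (Orb Λ₀)) ℂ) (huN : ∀ c, Commute totalNumberOp (u c))

/-- `𝒰ᴴ 𝒰 = 1` when every `u_cᴴ u_c = 1`. [folklore] -/
theorem conjTranspose_dressing_mul_self (hu : ∀ c, (u c)ᴴ * u c = 1) :
    (dressing φ hdisj u huN)ᴴ * dressing φ hdisj u huN = 1 :=
  conjTranspose_noncommProd_mul_self _ _ _ fun c _ => conjTranspose_fermionEmbed_mul_self (φ c) (hu c)

omit [DecidableEq C] in
/-- `𝒰` conserves the particle number. [folklore] -/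
theorem commute_totalNumberOp_dressing : Commute totalNumberOp (dressing φ hdisj u huN) :=
  commute_noncommProd_of_forall _ _ _ fun c _ => commute_totalNumberOp_fermionEmbed (φ c) (huN c)

/-- Splitting off one factor: `𝒰 = (∏_{c' ≠ c} Γ(φ_{c'}) u_{c'}) · Γ(φ_c) u_c`. [folklore] -/
theorem dressing_eq_erase_mul (c : C) :
    dressing φ hdisj u huN =
      (univ.erase c).noncommProd (fun c => fermionEmbed (φ c) (u c))
          ((pairwise_commute_fermionEmbed φ hdisj u huN).mono (coe_subset.2 (erase_subset _ _))) *
        fermionEmbed (φ c) (u c) :=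
  (Finset.noncommProd_erase_mul _ (mem_univ c) _ _).symm

omit [DecidableEq C] in
/-- The factors outside a window commute with the window: if every cell `c' ∈ s` has image
disjoint from that of `ψ`, then `∏_{c' ∈ s} Γ(φ_{c'}) u_{c'}` commutes with `Γ(ψ) B`.
[cite: BratteliRobinsonII1997, §5.2.2] -/
theorem commute_noncommProd_fermionEmbed {Λ' : Type*} [LinearOrder Λ'] [Fintype Λ'] (ψ : Λ' ↪ Λ)
    (s : Finset C) (hs : ∀ c ∈ s, Disjoint ((univ : Finset Λ₀).map (φ c)) ((univ : Finset Λ').map ψ))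
    (B : Matrix (Finset (Orb Λ')) (Finset (Orb Λ')) ℂ) :
    Commute (s.noncommProd (fun c => fermionEmbed (φ c) (u c))
        ((pairwise_commute_fermionEmbed φ hdisj u huN).mono (coe_subset.2 (subset_univ _))))
      (fermionEmbed ψ B) := by
  refine (Finset.noncommProd_commute s _ _ (fermionEmbed ψ B) fun c hc => ?_).symm
  exact (commute_fermionEmbed_of_disjoint (φ c) ψ (hs c hc)
    (mem_carEvenSubalgebra_univ_of_commute_totalNumberOp (huN c)) B).symm

/-- **Light cone for cell observables**: `𝒰ᴴ Γ(φ_c)X 𝒰 = Γ(φ_c)(u_cᴴ X u_c)`.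
[cite: BratteliRobinsonII1997, §5.2.2] -/
theorem dressing_conj_cell (hu : ∀ c, (u c)ᴴ * u c = 1) (c : C)
    (X : Matrix (Finset (Orb Λ₀)) (Finset (Orb Λ₀)) ℂ) :
    (dressing φ hdisj u huN)ᴴ * fermionEmbed (φ c) X * dressing φ hdisj u huN =
      fermionEmbed (φ c) ((u c)ᴴ * X * u c) := by
  rw [dressing_eq_erase_mul φ hdisj u huN c]
  refine conjTranspose_mul_fermionEmbed_mul_of_commute (φ c) ?_ (u c) X ?_
  · exact conjTranspose_noncommProd_mul_self _ _ _ fun c' _ =>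
      conjTranspose_fermionEmbed_mul_self (φ c') (hu c')
  · refine commute_noncommProd_fermionEmbed φ hdisj u huN (φ c) (univ.erase c) (fun c' hc' => ?_) X
    exact hdisj c' c (ne_of_mem_erase hc')

/-! ### Link windows made of two cells -/

variable {D : Type*} (ψ : D → (Λ₁ ↪ Λ)) (src tgt : D → C) (ι₁ ι₂ : Λ₀ ↪ Λ₁)
  (hne : ∀ ℓ, src ℓ ≠ tgt ℓ)
  (hsrc : ∀ ℓ, ι₁.trans (ψ ℓ) = φ (src ℓ)) (htgt : ∀ ℓ, ι₂.trans (ψ ℓ) = φ (tgt ℓ))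
  (hcover : ∀ z : Λ₁, z ∈ Set.range ι₁ ∨ z ∈ Set.range ι₂)

include hdisj hsrc htgt hcover in
omit [DecidableEq C] [LinearOrder Λ₀] [LinearOrder Λ₁] [LinearOrder Λ] [Fintype Λ] [Fintype C] huN in
/-- A cell other than the two cells of a link window is disjoint from the window. [folklore] -/
theorem disjoint_cell_link (ℓ : D) {c : C} (h₁ : c ≠ src ℓ) (h₂ : c ≠ tgt ℓ) :
    Disjoint ((univ : Finset Λ₀).map (φ c)) ((univ : Finset Λ₁).map (ψ ℓ)) := by
  rw [Finset.disjoint_left]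
  intro x hx hx'
  obtain ⟨z, -, rfl⟩ := Finset.mem_map.1 hx'
  rcases hcover z with ⟨a, rfl⟩ | ⟨a, rfl⟩
  · have hmem : (ψ ℓ) (ι₁ a) ∈ (univ : Finset Λ₀).map (φ (src ℓ)) := by
      rw [← hsrc ℓ]; exact Finset.mem_map_of_mem _ (mem_univ a)
    exact Finset.disjoint_left.1 (hdisj c (src ℓ) h₁) hx hmem
  · have hmem : (ψ ℓ) (ι₂ a) ∈ (univ : Finset Λ₀).map (φ (tgt ℓ)) := by
      rw [← htgt ℓ]; exact Finset.mem_map_of_mem _ (mem_univ a)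
    exact Finset.disjoint_left.1 (hdisj c (tgt ℓ) h₂) hx hmem

include hne hsrc htgt in
/-- Splitting off the two factors of a link: `𝒰 = (∏_{c ∉ {src,tgt}} Γ(φ_c)u_c) · Γ(ψ_ℓ) V_ℓ` with
`V_ℓ = Γ(ι₁) u_{src ℓ} · Γ(ι₂) u_{tgt ℓ}`. [folklore] -/
theorem dressing_eq_erase_erase_mul (ℓ : D) :
    dressing φ hdisj u huN =
      (((univ.erase (tgt ℓ)).erase (src ℓ)).noncommProd (fun c => fermionEmbed (φ c) (u c))
          ((pairwise_commute_fermionEmbed φ hdisj u huN).mono (coe_subset.2 (subset_univ _)))) *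
        fermionEmbed (ψ ℓ) (fermionEmbed ι₁ (u (src ℓ)) * fermionEmbed ι₂ (u (tgt ℓ))) := by
  have hmem : src ℓ ∈ univ.erase (tgt ℓ) := mem_erase.2 ⟨hne ℓ, mem_univ _⟩
  rw [fermionEmbed_mul, fermionEmbed_fermionEmbed, fermionEmbed_fermionEmbed, hsrc, htgt, dressing,
    ← Finset.noncommProd_erase_mul _ (mem_univ (tgt ℓ)), ← Finset.noncommProd_erase_mul _ hmem,
    Matrix.mul_assoc]

include hne hsrc htgt hcover in
/-- **Light cone for link observables**: `𝒰ᴴ Γ(ψ_ℓ)Y 𝒰 = Γ(ψ_ℓ)(V_ℓᴴ Y V_ℓ)` with the two-cell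
dressing `V_ℓ = Γ(ι₁) u_{src ℓ} · Γ(ι₂) u_{tgt ℓ}` of the link window. [cite: BratteliRobinsonII1997, §5.2.2] -/
theorem dressing_conj_link (hu : ∀ c, (u c)ᴴ * u c = 1) (ℓ : D)
    (Y : Matrix (Finset (Orb Λ₁)) (Finset (Orb Λ₁)) ℂ) :
    (dressing φ hdisj u huN)ᴴ * fermionEmbed (ψ ℓ) Y * dressing φ hdisj u huN =
      fermionEmbed (ψ ℓ) ((fermionEmbed ι₁ (u (src ℓ)) * fermionEmbed ι₂ (u (tgt ℓ)))ᴴ * Y *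
        (fermionEmbed ι₁ (u (src ℓ)) * fermionEmbed ι₂ (u (tgt ℓ)))) := by
  rw [dressing_eq_erase_erase_mul φ hdisj u huN ψ src tgt ι₁ ι₂ hne hsrc htgt ℓ]
  refine conjTranspose_mul_fermionEmbed_mul_of_commute (ψ ℓ) ?_ _ Y ?_
  · exact conjTranspose_noncommProd_mul_self _ _ _ fun c' _ =>
      conjTranspose_fermionEmbed_mul_self (φ c') (hu c')
  · refine commute_noncommProd_fermionEmbed φ hdisj u huN (ψ ℓ) _ (fun c hc => ?_) Y
    exact disjoint_cell_link φ hdisj ψ src tgt ι₁ ι₂ hsrc htgt hcover ℓ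
      (ne_of_mem_erase hc) (ne_of_mem_erase (mem_of_mem_erase hc))

/-! ### The bound -/

include hdisj huN hne hsrc htgt hcover in
/-- **The dressed-cluster energy bound.** Let `P` be an orthogonal projection on the one-particle
space `Orb Λ → ℂ` with `tr P = N`, let the cells `φ_c`, links `ψ_ℓ` and dressing operators `u_c`
(`u_cᴴ u_c = 1`, `[N̂, u_c] = 0`) be as above, and let `H` be cluster-decomposed,
`H = Σ_c Γ(φ_c) h₁(c) + Σ_ℓ Γ(ψ_ℓ) h₂(ℓ)`. Then
`E_N(H) ≤ Re [ Σ_c Σ_{s,t} (u_cᴴ h₁(c) u_c)_{st} · slaterRDM (P|_{φ_c}) s t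
             + Σ_ℓ Σ_{s,t} (V_ℓᴴ h₂(ℓ) V_ℓ)_{st} · slaterRDM (P|_{ψ_ℓ}) s t ]`,
`V_ℓ = Γ(ι₁) u_{src ℓ} Γ(ι₂) u_{tgt ℓ}` — the energy of the dressed Slater determinant
`(∏_c Γ(φ_c)u_c) Φ_P`, evaluated window by window by Wick's theorem. (Variational principle
BLS94 (2c.36); light cone; `groundStateFunctional_fermionEmbed`.) [cite: BachLiebSolovej1994, eq. (2c.36)] -/
theorem groundEnergy_le {P : Matrix (Orb Λ) (Orb Λ) ℂ} (hP : P.IsHermitian) (hPP : P * P = P)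
    {N : ℕ} (htr : P.trace = N) (hu : ∀ c, (u c)ᴴ * u c = 1)
    (H : Matrix (Finset (Orb Λ)) (Finset (Orb Λ)) ℂ)
    (h₁ : C → Matrix (Finset (Orb Λ₀)) (Finset (Orb Λ₀)) ℂ)
    (h₂ : D → Matrix (Finset (Orb Λ₁)) (Finset (Orb Λ₁)) ℂ) [Fintype D]
    (hH : H = ∑ c, fermionEmbed (φ c) (h₁ c) + ∑ ℓ, fermionEmbed (ψ ℓ) (h₂ ℓ)) :
    groundEnergy H N ≤
      ((∑ c, ∑ s : Finset (Orb Λ₀), ∑ t : Finset (Orb Λ₀), ((u c)ᴴ * h₁ c * u c) s t *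
          HartreeFock.slaterRDM (P.submatrix (fun a : Orb Λ₀ => orb (φ c (ofLex a).1) (ofLex a).2)
            (fun a : Orb Λ₀ => orb (φ c (ofLex a).1) (ofLex a).2)) s t) +
        ∑ ℓ, ∑ s : Finset (Orb Λ₁), ∑ t : Finset (Orb Λ₁),
          ((fermionEmbed ι₁ (u (src ℓ)) * fermionEmbed ι₂ (u (tgt ℓ)))ᴴ * h₂ ℓ *
            (fermionEmbed ι₁ (u (src ℓ)) * fermionEmbed ι₂ (u (tgt ℓ)))) s t *
          HartreeFock.slaterRDM (P.submatrix (fun a : Orb Λ₁ => orb (ψ ℓ (ofLex a).1) (ofLex a).2)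
            (fun a : Orb Λ₁ => orb (ψ ℓ (ofLex a).1) (ofLex a).2)) s t).re := by
  set 𝒰 := dressing φ hdisj u huN with h𝒰
  have hbound := HartreeFock.groundEnergy_le_re_groundStateFunctional_conj hP hPP htr H 𝒰
    (conjTranspose_dressing_mul_self φ hdisj u huN hu) (commute_totalNumberOp_dressing φ hdisj u huN)
  refine hbound.trans (le_of_eq ?_)
  congr 1
  rw [hH, Matrix.mul_add, Matrix.add_mul, Matrix.mul_sum, Matrix.sum_mul, Matrix.mul_sum,
    Matrix.sum_mul, map_add, map_sum, map_sum]
  congr 1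
  · refine Finset.sum_congr rfl fun c _ => ?_
    rw [dressing_conj_cell φ hdisj u huN hu c, HartreeFock.groundStateFunctional_fermionEmbed hP hPP htr]
  · refine Finset.sum_congr rfl fun ℓ _ => ?_
    rw [dressing_conj_link φ hdisj u huN ψ src tgt ι₁ ι₂ hne hsrc htgt hcover hu ℓ,
      HartreeFock.groundStateFunctional_fermionEmbed hP hPP htr]

end DressedCluster

end Literature.MathematicalPhysics.QuantumLattice
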